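import Mathlib
import Summits.PneNP.PneNP.Theorems.ConvexRankGatesConvexGateBlindAffinePencil

/-!
# PneNP / ConvexRankGates — `ConvexGateBlind`: the moment curve in `ℝ⁵` separates every PAIR of its points

Helpers (`--supports stmt-PneNP-10680`), COLUMN-SPACE line (prover seat 2, session 26), PSD side: the real-algebraic
ingredient of the six-dimensional exclusion construction (memo ANALYSIS-seat2-s26 §2.3, Proposition L). For parameters `t`
the MOMENT VECTOR `u(t) = (1, t, t², t³, t⁴)` and for a pair `a, b` the QUARTIC NORMAL `N(a,b)` = coefficient vector of
`1 − (t−a)²(t−b)²` satisfy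

* `quarticVec_dotProduct_momentVec` — `⟨N(a,b), u(t)⟩ = 1 − (t−a)²(t−b)²`: `= 1` at `t ∈ {a,b}` and `≤ 0` whenever
  `|t−a|, |t−b| ≥ 1` (`quarticVec_dotProduct_momentVec_nonpos`), in particular at every other NATURAL parameter
  (`quarticVec_dotProduct_momentVec_natCast_nonpos`): the crudest form of the 2-neighbourliness of the moment curve (cyclic
  polytopes) — every pair of its integer points is cut off from all the others by a linear functional;
* `quarticVec_eq_quarticVec` — `N(a,b)` determines `{a,b}` (for positive parameters), and `one_le_quarticVec_dotProduct_self`;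
* unit vectors: `unitOf v = v/‖v‖` has `⟨unitOf v, unitOf v⟩ = 1`, and two DISTINCT unit vectors have inner product `< 1`
  (`dotProduct_lt_one_of_ne`) — the angular gap that lets one large scale `L` dominate.
[folklore]
-/

set_option linter.dupNamespace false

namespace Summit.PneNP.PneNP.Theorems

open Finset Real Matrix

noncomputable section

/-! ## Moment vectors and quartic normals -/

/-- The moment vector `u(t) = (1, t, t², t³, t⁴) ∈ ℝ⁵`. [folklore] -/
def momentVec (t : ℝ) : Fin 5 → ℝ := ![1, t, t ^ 2, t ^ 3, t ^ 4]

/-- The quartic normal of the pair `(a, b)`: the coefficient vector of `1 − (t−a)²(t−b)²`. [folklore] -/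
def quarticVec (a b : ℝ) : Fin 5 → ℝ :=
  ![1 - a ^ 2 * b ^ 2, 2 * a * b * (a + b), -((a + b) ^ 2 + 2 * a * b), 2 * (a + b), -1]

/-- The quartic normal is symmetric in the pair. [folklore] -/
theorem quarticVec_comm (a b : ℝ) : quarticVec a b = quarticVec b a := by
  ext i
  fin_cases i <;> simp [quarticVec] <;> ring

/-- **Evaluation**: `⟨N(a,b), u(t)⟩ = 1 − (t−a)²(t−b)²`. [folklore] -/
theorem quarticVec_dotProduct_momentVec (a b t : ℝ) :
    quarticVec a b ⬝ᵥ momentVec t = 1 - (t - a) ^ 2 * (t - b) ^ 2 := by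
  simp [quarticVec, momentVec, dotProduct, Fin.sum_univ_five]
  ring

/-- At its own points the functional is `1`. [folklore] -/
theorem quarticVec_dotProduct_momentVec_left (a b : ℝ) : quarticVec a b ⬝ᵥ momentVec a = 1 := by
  rw [quarticVec_dotProduct_momentVec]; ring

/-- At its own points the functional is `1`. [folklore] -/
theorem quarticVec_dotProduct_momentVec_right (a b : ℝ) : quarticVec a b ⬝ᵥ momentVec b = 1 := by
  rw [quarticVec_dotProduct_momentVec]; ring

/-- **Separation**: at parameters at distance `≥ 1` from both `a` and `b` the functional is `≤ 0`. [folklore] -/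
theorem quarticVec_dotProduct_momentVec_nonpos {a b t : ℝ} (ha : 1 ≤ |t - a|) (hb : 1 ≤ |t - b|) :
    quarticVec a b ⬝ᵥ momentVec t ≤ 0 := by
  rw [quarticVec_dotProduct_momentVec]
  have h1 : 1 ≤ (t - a) ^ 2 := by
    have := sq_abs (t - a); nlinarith [abs_nonneg (t - a)]
  have h2 : 1 ≤ (t - b) ^ 2 := by
    have := sq_abs (t - b); nlinarith [abs_nonneg (t - b)]
  nlinarith

/-- Distinct naturals are at distance `≥ 1`. [folklore] -/
theorem one_le_abs_sub_natCast {p q : ℕ} (h : p ≠ q) : 1 ≤ |(p : ℝ) - q| := by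
  rcases lt_or_gt_of_ne h with hlt | hgt
  · have : (p : ℝ) + 1 ≤ q := by exact_mod_cast hlt
    rw [abs_of_neg (by linarith)]; linarith
  · have : (q : ℝ) + 1 ≤ p := by exact_mod_cast hgt
    rw [abs_of_pos (by linarith)]; linarith

/-- **Separation at natural parameters**: for naturals `t ∉ {a, b}`, `⟨N(a,b), u(t)⟩ ≤ 0`. [folklore] -/
theorem quarticVec_dotProduct_momentVec_natCast_nonpos {a b t : ℕ} (ha : t ≠ a) (hb : t ≠ b) :
    quarticVec (a : ℝ) b ⬝ᵥ momentVec t ≤ 0 :=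
  quarticVec_dotProduct_momentVec_nonpos (one_le_abs_sub_natCast ha) (one_le_abs_sub_natCast hb)

/-- The quartic normal has squared length `≥ 1` (its `t⁴`-coefficient is `−1`); in particular it is non-zero. [folklore] -/
theorem one_le_quarticVec_dotProduct_self (a b : ℝ) : 1 ≤ quarticVec a b ⬝ᵥ quarticVec a b := by
  simp only [quarticVec, dotProduct, Fin.sum_univ_five, Matrix.cons_val_zero, Matrix.cons_val_one, Matrix.head_cons,
    Matrix.cons_val_two, Matrix.tail_cons, Matrix.cons_val_three, Matrix.cons_val_four]
  nlinarith [sq_nonneg (1 - a ^ 2 * b ^ 2), sq_nonneg (2 * a * b * (a + b)), sq_nonneg ((a + b) ^ 2 + 2 * a * b),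
    sq_nonneg (2 * (a + b))]

/-- **The normal determines the pair** (positive parameters): equal normals have equal `a + b` and `ab`. [folklore] -/
theorem quarticVec_eq_quarticVec {a b c d : ℝ} (hab : 0 < a + b) (h : quarticVec a b = quarticVec c d) :
    a + b = c + d ∧ a * b = c * d := by
  have h3 := congrFun h 3
  have h1 := congrFun h 1
  simp [quarticVec] at h3 h1
  have hs : a + b = c + d := by linarith
  refine ⟨hs, ?_⟩
  rw [← hs] at h1
  have : (a * b - c * d) * (a + b) = 0 := by linarith
  rcases mul_eq_zero.1 this with h0 | h0
  · linarith
  · linarith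

/-- Two reals with the same sum and product as two others are the same pair. [folklore] -/
theorem pair_eq_of_sum_eq_of_mul_eq {a b c d : ℝ} (hs : a + b = c + d) (hp : a * b = c * d) :
    (a = c ∧ b = d) ∨ (a = d ∧ b = c) := by
  have key : (a - c) * (a - d) = a ^ 2 - a * (c + d) + c * d := by ring
  rw [← hs, ← hp] at key
  have : (a - c) * (a - d) = 0 := by rw [key]; ring
  rcases mul_eq_zero.1 this with h | h
  · left; constructor <;> linarith
  · right; constructor <;> linarith

/-! ## Unit vectors -/

/-- Normalisation `v / ‖v‖` (dot-product form). [folklore] -/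
def unitOf {d : ℕ} (v : Fin d → ℝ) : Fin d → ℝ := (1 / Real.sqrt (v ⬝ᵥ v)) • v

/-- `⟨v/‖v‖, w⟩ = ⟨v, w⟩/‖v‖`. [folklore] -/
theorem unitOf_dotProduct {d : ℕ} (v w : Fin d → ℝ) : unitOf v ⬝ᵥ w = (v ⬝ᵥ w) / Real.sqrt (v ⬝ᵥ v) := by
  rw [unitOf, smul_dotProduct]; simp [div_eq_inv_mul]

/-- `⟨w, v/‖v‖⟩ = ⟨w, v⟩/‖v‖`. [folklore] -/
theorem dotProduct_unitOf {d : ℕ} (w v : Fin d → ℝ) : w ⬝ᵥ unitOf v = (w ⬝ᵥ v) / Real.sqrt (v ⬝ᵥ v) := by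
  rw [dotProduct_comm, unitOf_dotProduct, dotProduct_comm]

/-- A normalised non-zero vector is a unit vector. [folklore] -/
theorem unitOf_dotProduct_self {d : ℕ} {v : Fin d → ℝ} (hv : 0 < v ⬝ᵥ v) : unitOf v ⬝ᵥ unitOf v = 1 := by
  rw [unitOf_dotProduct, dotProduct_unitOf]
  have hs : 0 < Real.sqrt (v ⬝ᵥ v) := Real.sqrt_pos.2 hv
  field_simp
  rw [Real.sq_sqrt hv.le]

/-- Unit vectors: `|⟨p, w⟩| ≤ ‖w‖` in squared form, `⟨p, w⟩² ≤ ⟨w, w⟩`. [folklore] -/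
theorem dotProduct_sq_le_of_unit {d : ℕ} {p : Fin d → ℝ} (hp : p ⬝ᵥ p = 1) (w : Fin d → ℝ) :
    (p ⬝ᵥ w) ^ 2 ≤ w ⬝ᵥ w := by
  have h := Finset.sum_mul_sq_le_sq_mul_sq (Finset.univ : Finset (Fin d)) p w
  have hp' : ∑ i, p i ^ 2 = 1 := by
    rw [← hp, dotProduct]; exact Finset.sum_congr rfl fun i _ => by ring
  have hw' : ∑ i, w i ^ 2 = w ⬝ᵥ w := by
    rw [dotProduct]; exact Finset.sum_congr rfl fun i _ => by ring
  rw [hp', one_mul, hw'] at h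
  simpa [dotProduct] using h

/-- Two unit vectors have inner product `≤ 1`. [folklore] -/
theorem dotProduct_le_one_of_unit {d : ℕ} {p p' : Fin d → ℝ} (hp : p ⬝ᵥ p = 1) (hp' : p' ⬝ᵥ p' = 1) :
    p ⬝ᵥ p' ≤ 1 := by
  have h := dotProduct_sq_le_of_unit hp p'
  rw [hp'] at h
  nlinarith

/-- **Distinct unit vectors have inner product `< 1`** (`‖p − p'‖² = 2 − 2⟨p,p'⟩`). [folklore] -/
theorem dotProduct_lt_one_of_ne {d : ℕ} {p p' : Fin d → ℝ} (hp : p ⬝ᵥ p = 1) (hp' : p' ⬝ᵥ p' = 1) (hne : p ≠ p') :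
    p ⬝ᵥ p' < 1 := by
  refine lt_of_le_of_ne (dotProduct_le_one_of_unit hp hp') fun h1 => hne ?_
  have hsq : (p - p') ⬝ᵥ (p - p') = 0 := by
    rw [sub_dotProduct, dotProduct_sub, dotProduct_sub, hp, hp', dotProduct_comm p' p, h1]; ring
  have := dotProduct_self_eq_zero.1 hsq
  exact sub_eq_zero.1 this

/-- **The large scale dominates two distinct directions**: for unit `p ≠ p'` and any `w`,
`⟨w + L(p + p'), w + L(p + p')⟩ ≤ ⟨w,w⟩ + 4L·√⟨w,w⟩… ` — in the squared, root-free form used downstream: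
`(w + L•(p + p')) ⬝ᵥ (w + L•(p + p')) = w ⬝ᵥ w + 2L(⟨w,p⟩ + ⟨w,p'⟩) + L²(2 + 2⟨p,p'⟩)`. [folklore] -/
theorem dotProduct_self_add_two_dirs {d : ℕ} {p p' : Fin d → ℝ} (hp : p ⬝ᵥ p = 1) (hp' : p' ⬝ᵥ p' = 1)
    (w : Fin d → ℝ) (L : ℝ) :
    (w + L • (p + p')) ⬝ᵥ (w + L • (p + p')) =
      w ⬝ᵥ w + 2 * L * (w ⬝ᵥ p + w ⬝ᵥ p') + L ^ 2 * (2 + 2 * (p ⬝ᵥ p')) := by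
  simp only [add_dotProduct, dotProduct_add, smul_dotProduct, dotProduct_smul, smul_eq_mul, hp, hp',
    dotProduct_comm p' p, dotProduct_comm p w, dotProduct_comm p' w]
  ring

/-- **One large direction**: `(w + L•p) ⬝ᵥ (w + L•p) = w ⬝ᵥ w + 2L⟨w,p⟩ + L²` for unit `p`. [folklore] -/
theorem dotProduct_self_add_dir {d : ℕ} {p : Fin d → ℝ} (hp : p ⬝ᵥ p = 1) (w : Fin d → ℝ) (L : ℝ) :
    (w + L • p) ⬝ᵥ (w + L • p) = w ⬝ᵥ w + 2 * L * (w ⬝ᵥ p) + L ^ 2 := by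
  simp only [add_dotProduct, dotProduct_add, smul_dotProduct, dotProduct_smul, smul_eq_mul, hp, dotProduct_comm p w]
  ring

/-- **The moment curve separates pairs** (registered form): for naturals `a ≠ b` and every natural `t`, the quartic normal
`N(a,b)` of `1 − (x−a)²(x−b)²` has `⟨N(a,b), u(t)⟩ = 1` if `t ∈ {a,b}` and `≤ 0` otherwise, `u(t) = (1,t,t²,t³,t⁴)`. [folklore] -/
theorem momentCurve_separates_pairs : ∀ (a b t : ℕ), (t = a ∨ t = b → quarticVec (a : ℝ) b ⬝ᵥ momentVec t = 1) ∧ (t ≠ a → t ≠ b → quarticVec (a : ℝ) b ⬝ᵥ momentVec t ≤ 0) :=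
  fun _ _ _ => ⟨fun h => h.elim (fun h => h ▸ quarticVec_dotProduct_momentVec_left _ _)
    (fun h => h ▸ quarticVec_dotProduct_momentVec_right _ _),
    fun ha hb => quarticVec_dotProduct_momentVec_natCast_nonpos ha hb⟩

end

end Summit.PneNP.PneNP.Theorems
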